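import Summits.ResolutionOfSingularities.ResolutionOfSingularities.Theorems.PurelyInseparableDim4ChartZigzagStep
import HarnessLib

/-!
# Purely inseparable four-folds: zigzag transport from ANY model piece (brick S3 (c) v4, tranche 1, brick A1e; cell `res-dim4-pi`)

[OURS · counted 0] (D-0157 DOOR 2; host item stmt-ResolutionOfSingularities-16155, helper). Nothing here proves resolution of
singularities in dimension ≥ 4 / characteristic `p`. `…ChartZigzagStep` §2 (typ-3 g5) transports ideal sheaves, points and CLOSEDNESS from a
full chart `φ₀ : 𝔸⁵ → Bl` of the model blow-up to the zigzag chart `W ←φ''— Y'' —ψ''→` of the stage. The v4 child package (A1, design memo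
`res-dim4-typ-3/S3c-V4-ATLAS-MEMBERS-DESIGN.md` §10 step (3)) transports typ-2's GLOBAL centre, which is not the image of one chart: the
range and closedness lemmas with the source of `φ₀` an ARBITRARY scheme `X₀` (e.g. `X₀ = Bl`, `φ₀ = 𝟙`), proofs verbatim.

* `zigzag_transport_range'`, **`zigzag_transport_isClosed'`** (`zigzag_transport_comap` / `_π_apply` of `…ChartZigzagStep` are already
  source-generic and are reused).

AI-produced formalisation, weaker than expert review. bears_on: LADDER-RESOLUTION:D157-DOOR2 (res-dim4-pi · S3 (c) v4 A1e).
-/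

set_option linter.dupNamespace false -- D-0017: single-problem summit path `Summit.<S>.<S>.…` by design

noncomputable section

open CategoryTheory AlgebraicGeometry Opposite TopologicalSpace

namespace Summit.ResolutionOfSingularities.ResolutionOfSingularities.Theorems.PIDim4

open Literature.AlgebraicGeometry.Resolution
open Literature.AlgebraicGeometry.Resolution.AffinePointBlowup (P A γ coord Wtop ξ)

namespace Equimultiple

section TransportAny

variable {K : Type} [Field K] {Z Y W Bl X₀ : Scheme.{0}} (φ : Y ⟶ Z) [IsOpenImmersion φ] (ψ : Y ⟶ P 4 K)
  [IsOpenImmersion ψ] {π : W ⟶ Z} {B : Bl ⟶ P 4 K}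
  (ε : (π ⁻¹ᵁ φ.opensRange : Scheme.{0}) ≅ (B ⁻¹ᵁ ψ.opensRange : Scheme.{0})) (φ₀ : X₀ ⟶ Bl)

omit [IsOpenImmersion φ] in
/-- **The zigzag piece sees a set `T ⊆ X₀`** as soon as `B ∘ φ₀` maps it into `ψ(Y)`. [folklore] -/
theorem zigzag_transport_range' (T : Set X₀) (hT : ∀ y ∈ T, B (φ₀ y) ∈ Set.range ψ) :
    T ⊆ Set.range (φ₀ ⁻¹ᵁ (B ⁻¹ᵁ ψ.opensRange)).ι := by
  intro y hy
  rw [Scheme.Opens.range_ι]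
  exact hT y hy

/-- **Closedness transports**: if `φ₀(T)` is closed in `Bl` and maps under `B` into a set `D` with `φ(ψ⁻¹ D)` closed in `Z`, then the
image of `T` in `W` through the zigzag piece is closed. (v4: `X₀ = Bl`, `φ₀ = 𝟙`, `T = V(Zc_model)`, `D` = the parent's base with the bundle
directions fixed — the fibre-closedness clause of `MemberAtlasZF`.) [cite: StacksProject, Tag 01J7] -/
theorem zigzag_transport_isClosed'
    (hsq : ε.hom ≫ (B ∣_ ψ.opensRange) = (π ∣_ φ.opensRange) ≫ (φ.isoOpensRange.inv ≫ ψ.isoOpensRange.hom))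
    (T : Set X₀) (D : Set (P 4 K)) (hTc : IsClosed (φ₀ '' T)) (hD : IsClosed (φ '' (ψ ⁻¹' D)))
    (hTD : ∀ y ∈ T, B (φ₀ y) ∈ D) :
    IsClosed (((φ₀ ∣_ (B ⁻¹ᵁ ψ.opensRange)) ≫ ε.inv ≫ (π ⁻¹ᵁ φ.opensRange).ι) ''
      ((φ₀ ⁻¹ᵁ (B ⁻¹ᵁ ψ.opensRange)).ι ⁻¹' T)) := by
  -- (i) the piece inside `B⁻¹ ψ(Y)` is closed there: it is `ι⁻¹ (φ₀ T)`
  have h1 : (φ₀ ∣_ (B ⁻¹ᵁ ψ.opensRange)) '' ((φ₀ ⁻¹ᵁ (B ⁻¹ᵁ ψ.opensRange)).ι ⁻¹' T) =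
      ((B ⁻¹ᵁ ψ.opensRange).ι : (B ⁻¹ᵁ ψ.opensRange : Scheme.{0}) → Bl) ⁻¹' (φ₀ '' T) := by
    ext z
    constructor
    · rintro ⟨y, hy, rfl⟩
      refine ⟨(φ₀ ⁻¹ᵁ (B ⁻¹ᵁ ψ.opensRange)).ι y, hy, ?_⟩
      rw [Scheme.Opens.ι_apply]
      change φ₀ y.1 = ((φ₀ ∣_ (B ⁻¹ᵁ ψ.opensRange)) y).1
      rw [morphismRestrict_base_coe]
    · rintro ⟨y, hyT, hyz⟩
      have hyO : y ∈ φ₀ ⁻¹ᵁ (B ⁻¹ᵁ ψ.opensRange) := by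
        change φ₀ y ∈ B ⁻¹ᵁ ψ.opensRange
        rw [hyz]
        exact z.2
      refine ⟨⟨y, hyO⟩, hyT, ?_⟩
      apply Subtype.ext
      rw [morphismRestrict_base_coe]
      exact hyz
  have h2 : IsClosed ((φ₀ ∣_ (B ⁻¹ᵁ ψ.opensRange)) '' ((φ₀ ⁻¹ᵁ (B ⁻¹ᵁ ψ.opensRange)).ι ⁻¹' T)) := by
    rw [h1]
    exact hTc.preimage (B ⁻¹ᵁ ψ.opensRange).ι.continuous
  -- (ii) transported along `ε⁻¹` it is closed in `π⁻¹ φ(Y)`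
  have h3 : ε.inv '' ((φ₀ ∣_ (B ⁻¹ᵁ ψ.opensRange)) '' ((φ₀ ⁻¹ᵁ (B ⁻¹ᵁ ψ.opensRange)).ι ⁻¹' T)) =
      (ε.hom : (π ⁻¹ᵁ φ.opensRange : Scheme.{0}) → (B ⁻¹ᵁ ψ.opensRange : Scheme.{0})) ⁻¹'
        ((φ₀ ∣_ (B ⁻¹ᵁ ψ.opensRange)) '' ((φ₀ ⁻¹ᵁ (B ⁻¹ᵁ ψ.opensRange)).ι ⁻¹' T)) := by
    ext q
    constructor
    · rintro ⟨z, hz, rfl⟩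
      show ε.hom (ε.inv z) ∈ (φ₀ ∣_ (B ⁻¹ᵁ ψ.opensRange)) '' ((φ₀ ⁻¹ᵁ (B ⁻¹ᵁ ψ.opensRange)).ι ⁻¹' T)
      rw [← Scheme.Hom.comp_apply, Iso.inv_hom_id]
      exact hz
    · intro hq
      refine ⟨ε.hom q, hq, ?_⟩
      rw [← Scheme.Hom.comp_apply, Iso.hom_inv_id]
      rfl
  have h4 : IsClosed (ε.inv '' ((φ₀ ∣_ (B ⁻¹ᵁ ψ.opensRange)) ''
      ((φ₀ ⁻¹ᵁ (B ⁻¹ᵁ ψ.opensRange)).ι ⁻¹' T))) := by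
    rw [h3]
    exact h2.preimage ε.hom.continuous
  -- (iii) its image in `W` lies over the closed `φ(ψ⁻¹ D) ⊆ φ(Y)`; hence it is closed in `W`
  have himage : ((φ₀ ∣_ (B ⁻¹ᵁ ψ.opensRange)) ≫ ε.inv ≫ (π ⁻¹ᵁ φ.opensRange).ι) ''
      ((φ₀ ⁻¹ᵁ (B ⁻¹ᵁ ψ.opensRange)).ι ⁻¹' T) =
      (π ⁻¹ᵁ φ.opensRange).ι '' (ε.inv '' ((φ₀ ∣_ (B ⁻¹ᵁ ψ.opensRange)) ''
        ((φ₀ ⁻¹ᵁ (B ⁻¹ᵁ ψ.opensRange)).ι ⁻¹' T))) := by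
    rw [Set.image_image, Set.image_image]
    refine Set.image_congr' fun y => ?_
    simp only [Scheme.Hom.comp_apply]
  -- where the zigzag piece maps to: `π(φ''(y)) = φ(q)` with `ψ(q) = B(φ₀ y)` (typ-3 g5's `zigzag_transport_π_apply`, any source)
  have he₁ι : φ.isoOpensRange.hom ≫ φ.opensRange.ι = φ := Scheme.Hom.isoOpensRange_hom_ι φ
  have he₂ι : ψ.isoOpensRange.hom ≫ ψ.opensRange.ι = ψ := Scheme.Hom.isoOpensRange_hom_ι ψ
  have hπψ : ∀ y : (φ₀ ⁻¹ᵁ (B ⁻¹ᵁ ψ.opensRange) : Scheme.{0}),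
      π (((φ₀ ∣_ (B ⁻¹ᵁ ψ.opensRange)) ≫ ε.inv ≫ (π ⁻¹ᵁ φ.opensRange).ι) y) =
        φ (ψ.isoOpensRange.inv ((B ∣_ ψ.opensRange) ((φ₀ ∣_ (B ⁻¹ᵁ ψ.opensRange)) y))) ∧
      ψ (ψ.isoOpensRange.inv ((B ∣_ ψ.opensRange) ((φ₀ ∣_ (B ⁻¹ᵁ ψ.opensRange)) y))) = B (φ₀ y.1) := by
    intro y
    constructor
    · have h1 : ((π ∣_ φ.opensRange) ≫ (φ.isoOpensRange.inv ≫ ψ.isoOpensRange.hom))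
          (ε.inv ((φ₀ ∣_ (B ⁻¹ᵁ ψ.opensRange)) y)) =
          (B ∣_ ψ.opensRange) ((φ₀ ∣_ (B ⁻¹ᵁ ψ.opensRange)) y) := by
        rw [← hsq, Scheme.Hom.comp_apply, ← Scheme.Hom.comp_apply ε.inv ε.hom, Iso.inv_hom_id]
        rfl
      have ha : ∀ q : Y, ψ.isoOpensRange.inv (ψ.isoOpensRange.hom q) = q := fun q => by
        rw [← Scheme.Hom.comp_apply, Iso.hom_inv_id]; rfl
      have hb : ∀ r : (φ.opensRange : Scheme.{0}), φ.isoOpensRange.hom (φ.isoOpensRange.inv r) = r := fun r => by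
        rw [← Scheme.Hom.comp_apply, Iso.inv_hom_id]; rfl
      have h2 : (π ∣_ φ.opensRange) (ε.inv ((φ₀ ∣_ (B ⁻¹ᵁ ψ.opensRange)) y)) =
          φ.isoOpensRange.hom (ψ.isoOpensRange.inv
            ((B ∣_ ψ.opensRange) ((φ₀ ∣_ (B ⁻¹ᵁ ψ.opensRange)) y))) := by
        rw [← h1]
        simp only [Scheme.Hom.comp_apply]
        rw [ha, hb]
      rw [Scheme.Hom.comp_apply, Scheme.Hom.comp_apply, ← Scheme.Hom.comp_apply _ π, ← morphismRestrict_ι,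
        Scheme.Hom.comp_apply, h2, ← Scheme.Hom.comp_apply _ φ.opensRange.ι, he₁ι]
    · have h3 : ψ.isoOpensRange.inv ≫ ψ = ψ.opensRange.ι := by
        rw [Iso.inv_comp_eq, he₂ι]
      have h4 : ((B ∣_ ψ.opensRange) ≫ ψ.isoOpensRange.inv ≫ ψ) ((φ₀ ∣_ (B ⁻¹ᵁ ψ.opensRange)) y) = B (φ₀ y.1) := by
        rw [h3, morphismRestrict_ι, Scheme.Hom.comp_apply, Scheme.Opens.ι_apply, morphismRestrict_base_coe]
      simpa only [Scheme.Hom.comp_apply] using h4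
  have hover : ((φ₀ ∣_ (B ⁻¹ᵁ ψ.opensRange)) ≫ ε.inv ≫ (π ⁻¹ᵁ φ.opensRange).ι) ''
      ((φ₀ ⁻¹ᵁ (B ⁻¹ᵁ ψ.opensRange)).ι ⁻¹' T) ⊆ π ⁻¹' (φ '' (ψ ⁻¹' D)) := by
    rintro _ ⟨y, hy, rfl⟩
    obtain ⟨hπy, hψy⟩ := hπψ y
    rw [Set.mem_preimage, hπy]
    refine ⟨_, ?_, rfl⟩
    rw [Set.mem_preimage, hψy]
    exact hTD y.1 hy
  rw [himage]
  refine ChartDictionary.isClosed_image_of_isInducing (π ⁻¹ᵁ φ.opensRange).ι.isOpenEmbedding.isInducing h4 ?_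
  rw [← himage]
  refine ((hD.preimage π.continuous).closure_subset_iff.mpr hover).trans ?_
  rintro w ⟨y, -, hyw⟩
  rw [Scheme.Opens.range_ι]
  change π w ∈ φ.opensRange
  rw [← hyw]
  exact ⟨y, rfl⟩

end TransportAny

end Equimultiple

end Summit.ResolutionOfSingularities.ResolutionOfSingularities.Theorems.PIDim4

end
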